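import Summits.BirchSwinnertonDyer.BirchSwinnertonDyer.Theorems.KatoDescentTamePotSupersingularTameUpperUnitTwistRecordToolsTprimeThree
import Summits.BirchSwinnertonDyer.BirchSwinnertonDyer.Theorems.Rank2ObservatoryConductorCert
import Summits.BirchSwinnertonDyer.BirchSwinnertonDyer.Theorems.Rank1ResidualIntModelReduction
import Summits.BirchSwinnertonDyer.Rank1Residual.Additive.GordKodairaType
import Literature.NumberTheory.DiophantineGeometry.ConductorExponentZeroProofs
import Literature.NumberTheory.DiophantineGeometry.ConductorMultiplicativeProofs
import Literature.NumberTheory.DiophantineGeometry.ConductorFactorizationProofs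
import Literature.NumberTheory.EllipticCurves.BSDConductor
import HarnessLib

/-!
# Route `KatoDescentTamePotSupersingular` (rung K8, sub-rung B4 (t′), cell `bsd-potss`): a kernel TOOL for the per-row records —
# Cremona's CONDUCTOR `N(E)` certified from an integer model (seat `bsd-potss-k8t-c4` g15; route-free; 0 definitions, 0 named facts,
# 0 `sorry`; closes nothing)

WHY. Every per-row unit-twist record of items 19202 / 19982 (g14, 273 rows) DISPLAYS the row's conductor as a binder
`hN : W.conductorNorm ℤ = N` (the Heegner hypothesis and the modular parametrisation are read at level `N`). This file makes
`N` KERNEL-CHECKABLE from the integer model: the conductor is `∏ p ^ f_p` (`WeierstrassCurve.factorization_conductorNorm_holds`,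
Silverman *AEC* C.16) with, at each prime,
* `p ∤ Δ(E₀)`: `f_p = 0` (good reduction; `conductorExponent_eq_zero_iff_holds`);
* `p ∣ Δ(E₀)`, `p ∤ c₄(E₀)`: `f_p = 1` (multiplicative; `conductorExponent_eq_one_iff_holds`);
* `p ≥ 5`, `p ∣ Δ, c₄`: `f_p = 2` (`conductorExponent_eq_two_of_five_le_of_isElliptic`, *ATAEC* IV.10.2(b));
* `p ∈ {2, 3}` additive: OGG'S FORMULA `f_p = ord_p Δ_min + 1 − m_p` (the tree's DEFINITION of `conductorExponent`) with the number of
  components `m_p` read off a KODAIRA SYMBOL CERTIFICATE — Tate's algorithm run forward on an integer model in Step-2 / Step-9 normal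
  form (`TateAlgorithm.kodairaSymbolOfMinimal_eq_II/III/IV_of_step2`, `…_eq_IIIstar/IIstar_of_step9`; divisibility tests only, so the
  types `I₀*`, `Iₙ*`, `IV*`, whose tests count roots over the residue field, are NOT covered here).
The reading lemma `kodairaSymbolAt_placeOf_eq_of_intModel` (any prime `p`; `p¹² ∤ Δ(N)` makes the model minimal at `p`) generalises the
`p = 3` case of `…RecordToolsTprimeThree` / `SolventPairLowerBound.kodairaSymbolAt_placeOf_three_eq_of_model`. The assembly
`conductorNorm_eq_of_exponents` takes the complete prime factorisation of `|Δ(E₀)|` (as in the records' Kraus certificates) and one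
exponent certificate per bad prime.

References: [SilvermanATAEC1994] IV.9.4, IV.10.2, IV.11.1 (Ogg's formula); [SilvermanAEC2009] VII.1 Rem. 1.1, VII.5.1, C.16; [Ogg1967];
[Cremona2006] Table 1 (the column N).
-/

set_option autoImplicit false
-- the Theorems directory repeats the summit name (sibling precedent `KatoDescentPotSupersingularAssembly.lean`)
set_option linter.dupNamespace false

noncomputable section

open scoped Classical

namespace Summit.BirchSwinnertonDyer.BirchSwinnertonDyer.Theorems.TameUpperUnitTwistRecords

open WeierstrassCurve IsLocalRing IsDedekindDomain Rat.HeightOneSpectrum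
  Literature.NumberTheory.DiophantineGeometry Literature.NumberTheory.DiophantineGeometry.TateAlgorithm
  Literature.NumberTheory.EllipticCurves Literature.NumberTheory.EllipticCurves.Rank1Residual
  Summit.BirchSwinnertonDyer.Rank1Residual Summit.BirchSwinnertonDyer.Rank1Residual.Additive
  Summit.BirchSwinnertonDyer.BirchSwinnertonDyer.Rank1Residual.IntModel
  Summit.BirchSwinnertonDyer.BirchSwinnertonDyer.Rank2Observatory.RootNumber
  Summit.BirchSwinnertonDyer.BirchSwinnertonDyer.Theorems.SolventPairLowerBound

/-! ## §1 Places and casts -/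

/-- The two spellings of the place of `ℤ` over a prime `p` agree (`natPlace` of the rank-2 observatory, `placeOf` of the b2b
dictionary). [folklore] -/
theorem natPlace_eq_placeOf (p : ℕ) [hp : Fact p.Prime] : natPlace p = placeOf p := by
  rw [natPlace, dif_pos hp.out]
  rfl

/-- `pⁿ ∣ x ↔ ϖⁿ ∣ x` in `ℤ_p` for the tree's chosen uniformiser `ϖ` of Tate's algorithm. [folklore] -/
private theorem prime_pow_dvd_iff (p : ℕ) [Fact p.Prime] (x : ℤ_[p]) (n : ℕ) :
    (p : ℤ_[p]) ^ n ∣ x ↔ uniformizer ℤ_[p] ^ n ∣ x := by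
  have h : Irreducible (p : ℤ_[p]) := PadicInt.irreducible_p
  rw [← mem_maximalIdeal_pow_iff_dvd_of_irreducible h, mem_maximalIdeal_pow_iff_dvd]

/-- `pⁿ ∣ a` in `ℤ` transported to the uniformiser of `ℤ_p`. [folklore] -/
private theorem unif_pow_dvd_cast (p : ℕ) [Fact p.Prime] (n : ℕ) (a : ℤ) (h : (p : ℤ) ^ n ∣ a) :
    uniformizer ℤ_[p] ^ n ∣ (a : ℤ_[p]) :=
  (prime_pow_dvd_iff p _ n).mp ((PadicInt.pow_p_dvd_int_iff (p := p) n a).mpr (by exact_mod_cast h))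

/-- `p ∣ a` in `ℤ` transported to the uniformiser of `ℤ_p`. [folklore] -/
private theorem unif_dvd_cast (p : ℕ) [Fact p.Prime] (a : ℤ) (h : (p : ℤ) ∣ a) :
    uniformizer ℤ_[p] ∣ (a : ℤ_[p]) := by
  simpa using unif_pow_dvd_cast p 1 a (by simpa using h)

/-- `ϖⁿ ∣ a` in `ℤ_p` back to `pⁿ ∣ a` in `ℤ`. [folklore] -/
private theorem pow_dvd_of_unif_pow_dvd_cast (p : ℕ) [Fact p.Prime] (n : ℕ) (a : ℤ)
    (h : uniformizer ℤ_[p] ^ n ∣ (a : ℤ_[p])) : (p : ℤ) ^ n ∣ a := by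
  have h' := (PadicInt.pow_p_dvd_int_iff (p := p) n a).mp ((prime_pow_dvd_iff p _ n).mpr h)
  exact_mod_cast h'

/-! ## §2 The Kodaira symbol at `p` read on an integer model (any prime `p`) -/

/-- **The census Kodaira symbol at `p` is Tate's algorithm on a user-supplied INTEGER model.** If `C • W = N` over `ℚ` for an integer
equation `N` with `p¹² ∤ Δ(N)` (hence `Δ(N) ≠ 0` and `N` minimal at `p`, Silverman *AEC* VII.1 Rem. 1.1), then
`W.kodairaSymbolAt (placeOf p) = (N ⊗ ℤ_p).kodairaSymbolOfMinimal` (*AEC* VII.1.3(b): the symbol does not depend on the minimal model;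
tree `kodairaSymbol_eq_kodairaSymbolOfMinimal_of_isMinimal`, `kodairaSymbolAt_placeOf_eq_padic`). The `p = 3` case is
`kodairaSymbolAt_three_eq_of_intModel`. [cite: SilvermanAEC2009, VII.1 Remark 1.1 and Prop. 1.3(b)] -/
theorem kodairaSymbolAt_placeOf_eq_of_intModel (p : ℕ) [Fact p.Prime] (W : WeierstrassCurve ℚ) [W.IsElliptic]
    (N : WeierstrassCurve ℤ) (C : VariableChange ℚ) (hC : C • W = N.map (Int.castRingHom ℚ))
    (h12 : ¬ (p : ℤ) ^ 12 ∣ N.Δ) :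
    W.kodairaSymbolAt (placeOf p) = (N.map (Int.castRingHom ℤ_[p])).kodairaSymbolOfMinimal := by
  haveI : Finite (ResidueField ℤ_[p]) := Finite.of_equiv _ (PadicInt.residueField (p := p)).toEquiv.symm
  have hirr : Irreducible (p : ℤ_[p]) := PadicInt.irreducible_p
  set φ : ℚ →+* ℚ_[p] := algebraMap ℚ ℚ_[p] with hφ
  set M : WeierstrassCurve ℤ_[p] := N.map (Int.castRingHom ℤ_[p]) with hM
  set ι := algebraMap ℤ_[p] ℚ_[p] with hι
  have hN0 : M.Δ ≠ 0 := by
    rw [hM, WeierstrassCurve.map_Δ]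
    intro h
    have h0 : N.Δ = 0 := (map_eq_zero_iff (Int.castRingHom ℤ_[p]) (RingHom.injective_int _)).mp h
    exact h12 (h0 ▸ dvd_zero _)
  have h12' : ¬ (p : ℤ_[p]) ^ 12 ∣ M.Δ := by
    rw [hM, WeierstrassCurve.map_Δ]
    intro h
    exact h12 (by exact_mod_cast (PadicInt.pow_p_dvd_int_iff (p := p) 12 N.Δ).mp (by simpa using h))
  -- `W ⊗ ℚ_p = (C ⊗ ℚ_p)⁻¹ • (M ⊗ ℚ_p)`
  have hmap : M.map ι = (N.map (Int.castRingHom ℚ)).map φ := by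
    rw [hM, WeierstrassCurve.map_map, WeierstrassCurve.map_map]
    congr 1
  have hE : W.baseChange ℚ_[p] = (C.map φ)⁻¹ • M.map ι := by
    rw [hmap, ← hC, ← WeierstrassCurve.map_variableChange, inv_smul_smul]
    rfl
  haveI hint : (M.map ι).IsIntegral ℤ_[p] := ⟨⟨M, rfl⟩⟩
  -- minimality of `M`: `v(Δ(M)) > exp(-12)`
  have hval : WithZero.exp (-12 : ℤ) <
      (IsDiscreteValuationRing.maximalIdeal ℤ_[p]).valuation ℚ_[p] (M.map ι).Δ := by
    rw [WeierstrassCurve.map_Δ, HeightOneSpectrum.valuation_of_algebraMap]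
    by_contra hle
    rw [not_lt, show (-12 : ℤ) = -((12 : ℕ) : ℤ) by norm_num,
      HeightOneSpectrum.intValuation_le_pow_iff_mem] at hle
    have hmem : M.Δ ∈ IsLocalRing.maximalIdeal ℤ_[p] ^ 12 := hle
    exact h12' ((mem_maximalIdeal_pow_iff_dvd_of_irreducible hirr _ _).mp hmem)
  haveI hmin : (M.map ι).IsMinimal ℤ_[p] := WeierstrassCurve.isMinimal_of_exp_lt_valuation_Δ (M.map ι) hval
  have hΔ0 : (M.map ι).Δ ≠ 0 := by
    rw [WeierstrassCurve.map_Δ]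
    exact fun h ↦ hN0 ((map_eq_zero_iff ι (IsFractionRing.injective ℤ_[p] ℚ_[p])).mp h)
  have hK := WeierstrassCurve.kodairaSymbol_eq_kodairaSymbolOfMinimal_of_isMinimal ℤ_[p]
    (W.baseChange ℚ_[p]) (M.map ι) ((C.map φ)⁻¹)⁻¹ (by rw [hE, inv_smul_smul]) hΔ0
  have hMint : (M.map ι).integralModel ℤ_[p] = M :=
    WeierstrassCurve.map_injective (IsFractionRing.injective ℤ_[p] ℚ_[p])
      (WeierstrassCurve.baseChange_integralModel_eq ℤ_[p] (M.map ι))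
  rw [kodairaSymbolAt_placeOf_eq_padic, hK, hMint]

section Types

variable (p : ℕ) [Fact p.Prime] (W : WeierstrassCurve ℚ) [W.IsElliptic]
  (N : WeierstrassCurve ℤ) (C : VariableChange ℚ) (hC : C • W = N.map (Int.castRingHom ℚ))
  (h12 : ¬ (p : ℤ) ^ 12 ∣ N.Δ)
include hC h12

/-- **Kodaira `II` at `p` from an integer Step-2 model**: `p ∣ Δ, a₃, a₄, a₆, b₂` and `p² ∤ a₆` (Step 3 fires).
[cite: SilvermanATAEC1994, IV.9.4 Steps 1–3 (PDF pp. 344–345)] -/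
theorem kodairaSymbolAt_placeOf_eq_II_of_intModel (hΔ : (p : ℤ) ∣ N.Δ)
    (n3 : (p : ℤ) ∣ N.a₃) (n4 : (p : ℤ) ∣ N.a₄) (n6 : (p : ℤ) ∣ N.a₆) (hb₂ : (p : ℤ) ∣ N.b₂)
    (ha₆ : ¬ (p : ℤ) ^ 2 ∣ N.a₆) :
    W.kodairaSymbolAt (placeOf p) = .II := by
  haveI : Finite (ResidueField ℤ_[p]) := Finite.of_equiv _ (PadicInt.residueField (p := p)).toEquiv.symm
  rw [kodairaSymbolAt_placeOf_eq_of_intModel p W N C hC h12]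
  refine kodairaSymbolOfMinimal_eq_II_of_step2 ?_ ?_ ?_ ?_ ?_ ?_
  · rw [WeierstrassCurve.map_Δ]; exact unif_dvd_cast p _ hΔ
  · rw [WeierstrassCurve.map_a₃]; exact unif_dvd_cast p _ n3
  · rw [WeierstrassCurve.map_a₄]; exact unif_dvd_cast p _ n4
  · rw [WeierstrassCurve.map_a₆]; exact unif_dvd_cast p _ n6
  · rw [WeierstrassCurve.map_b₂]; exact unif_dvd_cast p _ hb₂
  · rw [WeierstrassCurve.map_a₆]; exact fun h ↦ ha₆ (pow_dvd_of_unif_pow_dvd_cast p 2 _ h)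

/-- **Kodaira `III` at `p` from an integer Step-2 model**: `p ∣ Δ, a₃, a₄, b₂`, `p² ∣ a₆`, `p³ ∤ b₈` (Step 4 fires).
[cite: SilvermanATAEC1994, IV.9.4 Steps 1–4 (PDF pp. 344–345)] -/
theorem kodairaSymbolAt_placeOf_eq_III_of_intModel (hΔ : (p : ℤ) ∣ N.Δ)
    (n3 : (p : ℤ) ∣ N.a₃) (n4 : (p : ℤ) ∣ N.a₄) (n6 : (p : ℤ) ^ 2 ∣ N.a₆) (hb₂ : (p : ℤ) ∣ N.b₂)
    (hb₈ : ¬ (p : ℤ) ^ 3 ∣ N.b₈) :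
    W.kodairaSymbolAt (placeOf p) = .III := by
  haveI : Finite (ResidueField ℤ_[p]) := Finite.of_equiv _ (PadicInt.residueField (p := p)).toEquiv.symm
  rw [kodairaSymbolAt_placeOf_eq_of_intModel p W N C hC h12]
  refine kodairaSymbolOfMinimal_eq_III_of_step2 ?_ ?_ ?_ ?_ ?_ ?_ ?_
  · rw [WeierstrassCurve.map_Δ]; exact unif_dvd_cast p _ hΔ
  · rw [WeierstrassCurve.map_a₃]; exact unif_dvd_cast p _ n3
  · rw [WeierstrassCurve.map_a₄]; exact unif_dvd_cast p _ n4
  · rw [WeierstrassCurve.map_a₆]; exact unif_dvd_cast p _ ((dvd_pow_self (p : ℤ) two_ne_zero).trans n6)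
  · rw [WeierstrassCurve.map_b₂]; exact unif_dvd_cast p _ hb₂
  · rw [WeierstrassCurve.map_a₆]; exact unif_pow_dvd_cast p 2 _ n6
  · rw [WeierstrassCurve.map_b₈]; exact fun h ↦ hb₈ (pow_dvd_of_unif_pow_dvd_cast p 3 _ h)

/-- **Kodaira `IV` at `p` from an integer Step-2 model**: `p ∣ Δ, a₃, a₄, b₂`, `p² ∣ a₆`, `p³ ∣ b₈`, `p³ ∤ b₆` (Step 5 fires).
[cite: SilvermanATAEC1994, IV.9.4 Steps 1–5 (PDF pp. 344–345)] -/
theorem kodairaSymbolAt_placeOf_eq_IV_of_intModel (hΔ : (p : ℤ) ∣ N.Δ)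
    (n3 : (p : ℤ) ∣ N.a₃) (n4 : (p : ℤ) ∣ N.a₄) (n6 : (p : ℤ) ^ 2 ∣ N.a₆) (hb₂ : (p : ℤ) ∣ N.b₂)
    (hb₈ : (p : ℤ) ^ 3 ∣ N.b₈) (hb₆ : ¬ (p : ℤ) ^ 3 ∣ N.b₆) :
    W.kodairaSymbolAt (placeOf p) = .IV := by
  haveI : Finite (ResidueField ℤ_[p]) := Finite.of_equiv _ (PadicInt.residueField (p := p)).toEquiv.symm
  rw [kodairaSymbolAt_placeOf_eq_of_intModel p W N C hC h12]
  refine kodairaSymbolOfMinimal_eq_IV_of_step2 ?_ ?_ ?_ ?_ ?_ ?_ ?_ ?_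
  · rw [WeierstrassCurve.map_Δ]; exact unif_dvd_cast p _ hΔ
  · rw [WeierstrassCurve.map_a₃]; exact unif_dvd_cast p _ n3
  · rw [WeierstrassCurve.map_a₄]; exact unif_dvd_cast p _ n4
  · rw [WeierstrassCurve.map_a₆]; exact unif_dvd_cast p _ ((dvd_pow_self (p : ℤ) two_ne_zero).trans n6)
  · rw [WeierstrassCurve.map_b₂]; exact unif_dvd_cast p _ hb₂
  · rw [WeierstrassCurve.map_a₆]; exact unif_pow_dvd_cast p 2 _ n6
  · rw [WeierstrassCurve.map_b₈]; exact unif_pow_dvd_cast p 3 _ hb₈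
  · rw [WeierstrassCurve.map_b₆]; exact fun h ↦ hb₆ (pow_dvd_of_unif_pow_dvd_cast p 3 _ h)

/-- **Kodaira `III*` at `p` from an integer Step-9 model**: `p ∣ a₁`, `p² ∣ a₂`, `p³ ∣ a₃, a₄`, `p⁵ ∣ a₆`, `p⁴ ∤ a₄` (Step 9 fires).
[cite: SilvermanATAEC1994, IV.9.4 Steps 1–9 (PDF pp. 344–346)] -/
theorem kodairaSymbolAt_placeOf_eq_IIIstar_of_intModel
    (g1 : (p : ℤ) ∣ N.a₁) (g2 : (p : ℤ) ^ 2 ∣ N.a₂) (g3 : (p : ℤ) ^ 3 ∣ N.a₃) (g4 : (p : ℤ) ^ 3 ∣ N.a₄)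
    (g6 : (p : ℤ) ^ 5 ∣ N.a₆) (h9 : ¬ (p : ℤ) ^ 4 ∣ N.a₄) :
    W.kodairaSymbolAt (placeOf p) = .IIIstar := by
  haveI : Finite (ResidueField ℤ_[p]) := Finite.of_equiv _ (PadicInt.residueField (p := p)).toEquiv.symm
  rw [kodairaSymbolAt_placeOf_eq_of_intModel p W N C hC h12]
  refine kodairaSymbolOfMinimal_eq_IIIstar_of_step9 ?_ ?_ ?_ ?_ ?_ ?_
  · rw [WeierstrassCurve.map_a₁]; exact unif_dvd_cast p _ g1
  · rw [WeierstrassCurve.map_a₂]; exact unif_pow_dvd_cast p 2 _ g2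
  · rw [WeierstrassCurve.map_a₃]; exact unif_pow_dvd_cast p 3 _ g3
  · rw [WeierstrassCurve.map_a₄]; exact unif_pow_dvd_cast p 3 _ g4
  · rw [WeierstrassCurve.map_a₆]; exact unif_pow_dvd_cast p 5 _ g6
  · rw [WeierstrassCurve.map_a₄]; exact fun h ↦ h9 (pow_dvd_of_unif_pow_dvd_cast p 4 _ h)

/-- **Kodaira `II*` at `p` from an integer Step-9 model**: `p ∣ a₁`, `p² ∣ a₂`, `p³ ∣ a₃`, `p⁴ ∣ a₄`, `p⁵ ∣ a₆`, `p⁶ ∤ a₆`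
(Step 10 fires). [cite: SilvermanATAEC1994, IV.9.4 Steps 1–10 (PDF pp. 344–346)] -/
theorem kodairaSymbolAt_placeOf_eq_IIstar_of_intModel
    (g1 : (p : ℤ) ∣ N.a₁) (g2 : (p : ℤ) ^ 2 ∣ N.a₂) (g3 : (p : ℤ) ^ 3 ∣ N.a₃) (g4 : (p : ℤ) ^ 4 ∣ N.a₄)
    (g6 : (p : ℤ) ^ 5 ∣ N.a₆) (h10 : ¬ (p : ℤ) ^ 6 ∣ N.a₆) :
    W.kodairaSymbolAt (placeOf p) = .IIstar := by
  haveI : Finite (ResidueField ℤ_[p]) := Finite.of_equiv _ (PadicInt.residueField (p := p)).toEquiv.symm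
  rw [kodairaSymbolAt_placeOf_eq_of_intModel p W N C hC h12]
  refine kodairaSymbolOfMinimal_eq_IIstar_of_step9 ?_ ?_ ?_ ?_ ?_ ?_
  · rw [WeierstrassCurve.map_a₁]; exact unif_dvd_cast p _ g1
  · rw [WeierstrassCurve.map_a₂]; exact unif_pow_dvd_cast p 2 _ g2
  · rw [WeierstrassCurve.map_a₃]; exact unif_pow_dvd_cast p 3 _ g3
  · rw [WeierstrassCurve.map_a₄]; exact unif_pow_dvd_cast p 4 _ g4
  · rw [WeierstrassCurve.map_a₆]; exact unif_pow_dvd_cast p 5 _ g6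
  · rw [WeierstrassCurve.map_a₆]; exact fun h ↦ h10 (pow_dvd_of_unif_pow_dvd_cast p 6 _ h)

end Types

/-! ## §3 Conductor exponents at a prime, from the integer model -/

section Exponents

variable {W : WeierstrassCurve ℚ} [W.IsElliptic] [W.IsGloballyMinimal] {E₀ : WeierstrassCurve ℤ}
  (hI : integralModelInt W = E₀)
include hI

/-- **Ogg's formula at `p` from a Kodaira certificate**: for the globally minimal `W` with integer model `E₀`, `ord_p Δ(E₀) = n` and
`W.kodairaSymbolAt (placeOf p) = K`, the conductor exponent is `f_p = n + 1 − m(K)` — the tree's DEFINITION of `conductorExponent`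
(Ogg 1967 / Saito 1988; Silverman *ATAEC* IV.11.1) unfolded. [cite: SilvermanATAEC1994, IV.11.1 (Ogg's formula)] -/
theorem conductorExponent_placeOf_eq_of_kodairaSymbolAt (p : ℕ) [Fact p.Prime] {K : KodairaSymbol}
    (hK : W.kodairaSymbolAt (placeOf p) = K) {n : ℕ} (hΔ : (p : ℤ) ^ n ∣ E₀.Δ) (hΔ' : ¬ (p : ℤ) ^ (n + 1) ∣ E₀.Δ) :
    W.conductorExponent (placeOf p) = n + 1 - K.numComponents := by
  rw [conductorExponent_def, WeierstrassCurve.numComponentsAt, hK, ordMinimalDiscriminant_placeOf_eq W p,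
    minimalDiscriminantInt_eq hI, padicValInt_eq_of_dvd_of_not_dvd p hΔ hΔ']

omit [W.IsElliptic] in
/-- `W` is the rational image of its integer model (bridge to the `W₀.baseChange ℚ` spelling of the observatory lemmas). [folklore] -/
private theorem eq_baseChange_of_intModel : W = E₀.baseChange ℚ := by
  rw [← hI, WeierstrassCurve.baseChange, algebraMap_int_eq, map_integralModelInt]

/-- **`f_p = 0` at a prime `p ∤ Δ(E₀)`** (good reduction, Silverman *AEC* VII.5.1(a); `conductorExponent_eq_zero_iff_holds`).
[cite: SilvermanAEC2009, VII.5 Prop. 5.1(a)] [cite: SilvermanATAEC1994, Thm. IV.10.2(a)] -/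
theorem conductorExponent_natPlace_eq_zero_of_not_dvd {p : ℕ} (hp : p.Prime) (h : ¬ (p : ℤ) ∣ E₀.Δ) :
    W.conductorExponent (natPlace p) = 0 := by
  have hW := eq_baseChange_of_intModel hI
  subst hW
  haveI : PerfectField (IsLocalRing.ResidueField ((natPlace p).adicCompletionIntegers ℚ)) := PerfectField.ofFinite
  exact (conductorExponent_eq_zero_iff_holds (natPlace p) (E₀.baseChange ℚ)).mpr
    (hasGoodReductionAt_of_not_dvd (by rwa [natGenerator_natPlace hp]))

/-- **`f_p = 1` at a multiplicative prime**: `p ∣ Δ(E₀)`, `p ∤ c₄(E₀)` (Silverman *AEC* VII.1 Rem. 1.1, VII.5.1(b);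
`conductorExponent_eq_one_iff_holds`). [cite: SilvermanAEC2009, VII.5 Prop. 5.1(b)] [cite: SilvermanATAEC1994, Thm. IV.10.2(b)] -/
theorem conductorExponent_natPlace_eq_one_of_dvd_of_not_dvd {p : ℕ} (hp : p.Prime) (hΔ : (p : ℤ) ∣ E₀.Δ)
    (hc₄ : ¬ (p : ℤ) ∣ E₀.c₄) : W.conductorExponent (natPlace p) = 1 := by
  have hW := eq_baseChange_of_intModel hI
  subst hW
  haveI : PerfectField (IsLocalRing.ResidueField ((natPlace p).adicCompletionIntegers ℚ)) := PerfectField.ofFinite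
  exact (conductorExponent_eq_one_iff_holds (natPlace p) (E₀.baseChange ℚ)).mpr
    (hasMultiplicativeReductionAt_of_dvd_of_not_dvd (by rwa [natGenerator_natPlace hp]) (by rwa [natGenerator_natPlace hp]))

/-- **`f_p = 2` at an additive prime `p ≥ 5`**: `pⁿ ∥ Δ(E₀)` with `1 ≤ n < 12` and `p ∣ c₄(E₀)` (Silverman *ATAEC* IV.10.2(b), IV.10.4;
`conductorExponent_eq_two_of_five_le_of_isElliptic` with the observatory's `hasAdditiveReductionAt_of_dvd`).
[cite: SilvermanATAEC1994, Thm. IV.10.2(b) and IV.10.4] -/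
theorem conductorExponent_natPlace_eq_two_of_five_le {p : ℕ} (hp : p.Prime) (h5 : 5 ≤ p) {n : ℕ} (hn : 1 ≤ n)
    (hΔ : (p : ℤ) ^ n ∣ E₀.Δ) (hΔ' : ¬ (p : ℤ) ^ (n + 1) ∣ E₀.Δ) (hn12 : n < 12) (hc₄ : (p : ℤ) ∣ E₀.c₄) :
    W.conductorExponent (natPlace p) = 2 := by
  have hW := eq_baseChange_of_intModel hI
  subst hW
  refine conductorExponent_eq_two_of_five_le_of_isElliptic (E₀.baseChange ℚ) (natPlace p)
    (by rwa [natGenerator_natPlace hp]) ?_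
  exact hasAdditiveReductionAt_of_dvd (natPlace p) hn (by rwa [natGenerator_natPlace hp])
    (by rwa [natGenerator_natPlace hp]) (Or.inl hn12) (by rwa [natGenerator_natPlace hp])

/-- **Ogg's formula at `natPlace p`** (the `placeOf` statement `conductorExponent_placeOf_eq_of_kodairaSymbolAt` respelled for the
assembly). [cite: SilvermanATAEC1994, IV.11.1 (Ogg's formula)] -/
theorem conductorExponent_natPlace_eq_of_kodairaSymbolAt (p : ℕ) [Fact p.Prime] {K : KodairaSymbol}
    (hK : W.kodairaSymbolAt (placeOf p) = K) {n : ℕ} (hΔ : (p : ℤ) ^ n ∣ E₀.Δ) (hΔ' : ¬ (p : ℤ) ^ (n + 1) ∣ E₀.Δ) :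
    W.conductorExponent (natPlace p) = n + 1 - K.numComponents := by
  rw [natPlace_eq_placeOf]
  exact conductorExponent_placeOf_eq_of_kodairaSymbolAt hI p hK hΔ hΔ'

end Exponents

/-! ## §4 Assembly: `N(E) = ∏ p ^ f_p` -/

/-- A prime dividing `∏ q ^ f` over a list of primes is one of the listed primes. [folklore] -/
theorem mem_of_prime_dvd_prod_pow {F : List (ℕ × ℕ)} (hFp : ∀ qf ∈ F, qf.1.Prime) {p : ℕ} (hp : p.Prime)
    (hd : p ∣ (F.map fun qf : ℕ × ℕ => qf.1 ^ qf.2).prod) : p ∈ F.map Prod.fst := by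
  induction F with
  | nil =>
    rw [List.map_nil, List.prod_nil, Nat.dvd_one] at hd
    exact absurd hd hp.one_lt.ne'
  | cons a F ih =>
    rw [List.map_cons, List.prod_cons] at hd
    rcases (Nat.Prime.dvd_mul hp).mp hd with h | h
    · have := (Nat.prime_dvd_prime_iff_eq hp (hFp a List.mem_cons_self)).mp (hp.dvd_of_dvd_pow h)
      exact List.mem_map.mpr ⟨a, List.mem_cons_self, this.symm⟩
    · obtain ⟨x, hx, hq⟩ := List.mem_map.mp (ih (fun x hx ↦ hFp x (List.mem_cons_of_mem _ hx)) h)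
      exact List.mem_map.mpr ⟨x, List.mem_cons_of_mem _ hx, hq⟩

/-- A prime dividing an integer whose absolute value is completely factored over a list of primes is one of the listed primes.
[folklore] -/
theorem mem_of_prime_dvd_of_natAbs_eq_prod {d : ℤ} {G : List (ℕ × ℕ)}
    (hfac : d.natAbs = (G.map fun qe : ℕ × ℕ => qe.1 ^ qe.2).prod) (hGp : ∀ qe ∈ G, qe.1.Prime)
    {p : ℕ} (hp : p.Prime) (hdvd : (p : ℤ) ∣ d) : p ∈ G.map Prod.fst :=
  mem_of_prime_dvd_prod_pow hGp hp (hfac ▸ Int.natCast_dvd.mp hdvd)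

/-- The `p`-adic exponent of `∏ q ^ f` vanishes at a prime `p` not listed. [folklore] -/
theorem factorization_prod_pow_of_not_mem {F : List (ℕ × ℕ)} (hFp : ∀ qf ∈ F, qf.1.Prime)
    {p : ℕ} (hp : p.Prime) (hnot : p ∉ F.map Prod.fst) :
    (F.map fun qf : ℕ × ℕ => qf.1 ^ qf.2).prod.factorization p = 0 :=
  Nat.factorization_eq_zero_of_not_dvd fun hd ↦ hnot (mem_of_prime_dvd_prod_pow hFp hp hd)

/-- The `p`-adic exponent of `∏ q ^ f` over a list with distinct prime first components: `f` at a listed `q`. [folklore] -/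
theorem factorization_prod_pow_of_mem {F : List (ℕ × ℕ)} (hFp : ∀ qf ∈ F, qf.1.Prime) (hnd : (F.map Prod.fst).Nodup)
    {qf : ℕ × ℕ} (hqf : qf ∈ F) : (F.map fun qf : ℕ × ℕ => qf.1 ^ qf.2).prod.factorization qf.1 = qf.2 := by
  induction F with
  | nil => simp at hqf
  | cons a F ih =>
    have hFp' : ∀ x ∈ F, x.1.Prime := fun x hx ↦ hFp x (List.mem_cons_of_mem _ hx)
    have hprod : (F.map fun qf : ℕ × ℕ => qf.1 ^ qf.2).prod ≠ 0 := by
      rw [Ne, List.prod_eq_zero_iff, List.mem_map]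
      rintro ⟨x, hx, h0⟩
      exact pow_ne_zero _ (hFp' x hx).ne_zero h0
    rw [List.map_cons, List.nodup_cons] at hnd
    rw [List.map_cons, List.prod_cons,
      Nat.factorization_mul (pow_ne_zero _ (hFp a List.mem_cons_self).ne_zero) hprod, Finsupp.add_apply,
      Nat.Prime.factorization_pow (hFp a List.mem_cons_self)]
    rcases List.mem_cons.mp hqf with rfl | h
    · rw [Finsupp.single_eq_same, factorization_prod_pow_of_not_mem hFp' (hFp qf List.mem_cons_self) hnd.1]
      simp
    · have hne : a.1 ≠ qf.1 := fun heq ↦ hnd.1 (heq ▸ List.mem_map.mpr ⟨qf, h, rfl⟩)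
      rw [Finsupp.single_apply, if_neg hne, zero_add]
      exact ih hFp' hnd.2 h

/-- **The conductor from per-prime exponent certificates.** For the globally minimal `W/ℚ` with integer model `E₀`, a complete prime
factorisation `|Δ(E₀)| = ∏_{(q,e) ∈ G} qᵉ` (as in the records' Kraus certificates) and a list `F` of (prime, exponent) pairs with
distinct primes containing every prime of `G` such that `f_q(W) = f` for every `(q, f) ∈ F` (each discharged by
`conductorExponent_natPlace_eq_one_of_dvd_of_not_dvd` / `…_eq_two_of_five_le` / `…_eq_of_kodairaSymbolAt`), the conductor is
`N(W) = ∏_{(q,f) ∈ F} q ^ f` (`factorization_conductorNorm_holds`, *AEC* C.16; `f_p = 0` off `Δ`, *ATAEC* IV.10.2(a)).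
[cite: SilvermanAEC2009, C.16] [cite: SilvermanATAEC1994, Thm. IV.10.2] -/
theorem conductorNorm_eq_of_exponents {W : WeierstrassCurve ℚ} [W.IsElliptic] [W.IsGloballyMinimal] {E₀ : WeierstrassCurve ℤ}
    (hI : integralModelInt W = E₀) {G : List (ℕ × ℕ)}
    (hfac : E₀.Δ.natAbs = (G.map fun qe : ℕ × ℕ => qe.1 ^ qe.2).prod) (hGp : ∀ qe ∈ G, qe.1.Prime)
    (F : List (ℕ × ℕ)) (hFp : ∀ qf ∈ F, qf.1.Prime) (hnd : (F.map Prod.fst).Nodup)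
    (hGF : ∀ q ∈ G.map Prod.fst, q ∈ F.map Prod.fst)
    (hexp : ∀ qf ∈ F, W.conductorExponent (natPlace qf.1) = qf.2) :
    W.conductorNorm ℤ = (F.map fun qf : ℕ × ℕ => qf.1 ^ qf.2).prod := by
  have hprod : (F.map fun qf : ℕ × ℕ => qf.1 ^ qf.2).prod ≠ 0 := by
    rw [Ne, List.prod_eq_zero_iff, List.mem_map]
    rintro ⟨x, hx, h0⟩
    exact pow_ne_zero _ (hFp x hx).ne_zero h0
  refine Nat.eq_of_factorization_eq (conductorNorm_pos_holds W : 0 < W.conductorNorm ℤ).ne' hprod fun p ↦ ?_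
  by_cases hp : p.Prime
  · have hf := factorization_conductorNorm_holds W (natPlace p)
    rw [natGenerator_natPlace hp] at hf
    rw [hf]
    by_cases hmem : p ∈ F.map Prod.fst
    · obtain ⟨qf, hqf, rfl⟩ := List.mem_map.mp hmem
      rw [hexp qf hqf, factorization_prod_pow_of_mem hFp hnd hqf]
    · rw [factorization_prod_pow_of_not_mem hFp hp hmem]
      refine conductorExponent_natPlace_eq_zero_of_not_dvd hI hp fun hdvd ↦ hmem (hGF p ?_)
      exact mem_of_prime_dvd_of_natAbs_eq_prod hfac hGp hp hdvd
  · rw [Nat.factorization_eq_zero_of_not_prime _ hp, Nat.factorization_eq_zero_of_not_prime _ hp]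

end Summit.BirchSwinnertonDyer.BirchSwinnertonDyer.Theorems.TameUpperUnitTwistRecords
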